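import Summits.PneNP.PneNP.Theorems.PermanentDescentCollapseMakesPermanentEasyDefs
import Mathlib.Data.Nat.Bitwise

/-!
# Route PermanentDescent, crux `CollapseMakesPermanentEasy` (stmt-PneNP-16142), line `birth` v2 — `stub_soundT`

Registered stub `stub_soundT` of the skeleton `Cruxes/CollapseMakesPermanentEasy/Lines/birth.lean` (v2), over the
objects of `Theorems/PermanentDescentCollapseMakesPermanentEasyDefs.lean` (namespace
`Summit.PneNP.PneNP.Theorems.PermCert`): SOUNDNESS of the Laplace certificate — a table `W` that
is good up to length `N` (`GoodT χ W B N`) answers every bit query `⟨s, bin i⟩`, `|s| = m² ≤ N`,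
`i < B`, by the true bit `i` of the permanent `permWord m s`.

Proof. Bit `i < B` of the table's value `valT χ W B s` (binary digits = the answers, least
significant first) is the answer `ansT χ W s i` (`testBit` of `bitsToNat` reads the list). By
induction on the side `m` the values of a good table ARE the permanents: at `m = 0` the word is
empty and both sides are `1` (`rhsT` at the empty word; `permWord 0 s = 1`, hypothesis); at side
`k + 1` goodness gives `valT s = laplaceSum k s (valT χ W B)` (`Nat.sqrt ((k+1)²) = k + 1`), every
minor word `minorWord k j s` has length `k²` with `k² ≤ (k+1)² ≤ N`, so by the induction hypothesis
the Laplace sum is `laplaceSum k s (permWord k) = permWord (k + 1) s` (the Laplace hypothesis).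
-/

set_option linter.dupNamespace false -- `Summit.PneNP.PneNP.…`: summit = sub-problem name (D-0017 single-conjunct layout)

namespace Summit.PneNP.PneNP.Theorems.PermCert

open _root_.Computability
open Literature.Computability.Complexity Literature.Computability.Complexity.Brick

/-- A minor word of side `k` has length `k²`. [folklore] -/
private theorem soundT_length_minorWord (k j : ℕ) (s : List Bool) :
    (minorWord k j s).length = k * k := by
  simp [minorWord]

/-- `bitsToNat` reads least significant bit first: bit `t` of the value is entry `t` of the list
(re-proof of the private `testBit_bitsToNat` of `MPGSignVerifierWitness.lean`, cf. the public twin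
`Com.testBit_bitsToNat` of `StackWordArith.lean`, not imported here). [folklore] -/
private theorem soundT_testBit_bitsToNat :
    ∀ (l : List Bool) (t : ℕ), (bitsToNat l).testBit t = l.getD t false
  -- adapted from Literature/Computability/Complexity/StackWordArith.lean (`Com.testBit_bitsToNat`)
  | [], t => by simp
  | b :: l, 0 => by
    rw [bitsToNat_cons, show b.toNat + 2 * bitsToNat l = Nat.bit b (bitsToNat l) by
      rw [Nat.bit_val]; ring]
    simp
  | b :: l, t + 1 => by
    rw [bitsToNat_cons, show b.toNat + 2 * bitsToNat l = Nat.bit b (bitsToNat l) by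
      rw [Nat.bit_val]; ring, Nat.testBit_bit_succ, soundT_testBit_bitsToNat l t]
    simp

/-- Bit `i < B` of the table's value of `s` is the table's answer to the query `⟨s, bin i⟩`. [folklore] -/
private theorem soundT_testBit_valT (χ : List Bool → Bool) (W : List (List Bool)) (B : ℕ)
    (s : List Bool) {i : ℕ} (hi : i < B) : (valT χ W B s).testBit i = ansT χ W s i := by
  rw [valT, soundT_testBit_bitsToNat, List.getD_eq_getElem?_getD, List.getElem?_map,
    List.getElem?_range hi]
  rfl

/-- The Laplace sum only depends on the values of `v` at the minor words. [folklore] -/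
private theorem soundT_laplaceSum_congr (k : ℕ) (s : List Bool) (v v' : List Bool → ℕ)
    (h : ∀ j, v (minorWord k j s) = v' (minorWord k j s)) :
    laplaceSum k s v = laplaceSum k s v' := by
  unfold laplaceSum
  congr 1
  refine List.map_congr_left fun j _ => ?_
  rw [h j]

/-- **The values of a good table are the permanents**: if `W` is good up to length `N`, then
`valT χ W B s = permWord m s` for every word `s` of length `m² ≤ N` (induction on the side `m`
along the Laplace row expansion). [folklore] -/
private theorem soundT_valT_eq_permWord (χ : List Bool → Bool) (W : List (List Bool)) (B N : ℕ)
    (hL0 : ∀ s : List Bool, permWord 0 s = 1)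
    (hLap : ∀ (k : ℕ) (s : List Bool), permWord (k + 1) s = laplaceSum k s (permWord k))
    (hG : GoodT χ W B N) :
    ∀ (m : ℕ) (s : List Bool), s.length = m * m → m * m ≤ N → valT χ W B s = permWord m s := by
  intro m
  induction m with
  | zero =>
    intro s hs _
    obtain rfl : s = [] := by simpa using hs
    rw [hG [] (by simp) (by simp), rhsT, if_pos List.length_nil, hL0]
  | succ k ih =>
    intro s hs hN
    have hsq : Nat.sqrt s.length = k + 1 := by rw [hs, Nat.sqrt_eq]
    have hne : s.length ≠ 0 := by rw [hs]; simp
    rw [hG s (by rw [hsq, hs]) (by rw [hs]; exact hN), rhsT, if_neg hne, hsq, Nat.add_sub_cancel,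
      hLap]
    exact soundT_laplaceSum_congr k s _ _ fun j =>
      ih (minorWord k j s) (soundT_length_minorWord k j s)
        ((Nat.mul_self_le_mul_self (Nat.le_succ k)).trans hN)

/-- **Soundness of the Laplace certificate.** If the permanent in the word encoding satisfies
`permWord 0 s = 1` and the row-`0` Laplace expansion `permWord (k+1) s = laplaceSum k s (permWord k)`,
then every table `W` that is good up to length `N` (`GoodT χ W B N`: its values pass the Laplace test
at all square words of length `≤ N`) answers each bit query correctly: for `|s| = m² ≤ N` and `i < B`,
`ansT χ W s i` is bit `i` of `permWord m s`. (The values of a good table are the permanents by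
induction on the side; bit `i` of the value is the `i`-th answer.) Source: the self-reducibility /
checkability of the permanent along its Laplace expansion, H. Minc, *Permanents* (1978), §1.2, as used
in Karp–Lipton-type search-to-decision arguments (S. Arora, B. Barak, *Computational Complexity*
(2009), Thm. 6.19, §8.6.2). [folklore] -/
theorem stub_soundT :
    ∀ (χ : List Bool → Bool) (W : List (List Bool)) (B N : ℕ),
      (∀ s : List Bool, permWord 0 s = 1) →
      (∀ (k : ℕ) (s : List Bool), permWord (k + 1) s = laplaceSum k s (permWord k)) →
      GoodT χ W B N →
      ∀ (m : ℕ) (s : List Bool) (i : ℕ), s.length = m * m → m * m ≤ N → i < B →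
        ansT χ W s i = (permWord m s).testBit i := by
  intro χ W B N hL0 hLap hG m s i hs hN hi
  rw [← soundT_valT_eq_permWord χ W B N hL0 hLap hG m s hs hN, soundT_testBit_valT χ W B s hi]

end Summit.PneNP.PneNP.Theorems.PermCert
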